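import Summits.Parity.GeneralizedHardyLittlewood.Theorems.PrimeLevelFamEdgeMomentsBeyondDiagonalDiagLineTail
import Summits.Parity.GeneralizedHardyLittlewood.Theorems.BeyondDiagonalBeatsQuarter.PeterssonSplitDiagLine
import HarnessLib

/-!
# Route `PrimeLevelFamEdge`, crux K_A `MomentsBeyondDiagonal` (stmt-Parity-20007), line «petersson_layers» v4, stub `stub_diag`:
# THE BOX TAIL OF A DIAGONAL LINE IN THE TREE'S VARIABLES — `≪ (q̂²M²/q⁴)^A (q²+1)^{i+j+1} (1 + log q̂ + 2 log M)^{i+j}`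

`…DiagLineSeries` (p811381) writes `diagPart` as the explicit line series minus, per `(m₁, m₂, d₁ ∣ m₁, d₂ ∣ m₂)`, the tail
`Σ'_{l≥0} g(l+1+T⋆)` with `T⋆ = min(q²/(d₁e₁), q²/(d₂e₂))`, `y = K/q̂²`, `A_ν = log(q̂/(d_νe_ν))`; `…DiagLineTail` (p811528) bounds it by
`C_A(i)C_A(j)(1+|A₁|)^i(1+|A₂|)^j ζ₂ · y^{−A}(T⋆+1)^{i+j+1−2A}`. This file supplies the LINE GEOMETRY that turns that into a bound in
`q, q̂, M` alone (`1 ≤ m_ν ≤ M`):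
* `K = (d₁e₁)(d₂e₂)` (`line_prod` at `t = 1`), `1 ≤ d_νe_ν ≤ M²`, hence `|A_ν| ≤ log q̂ + 2 log M` (`q̂ ≥ 1`);
* `(d_max e_max)(T⋆ + 1) > q²`, hence `y (T⋆+1)² ≥ q⁴/(q̂² M²)`; and `T⋆ + 1 ≤ q² + 1`;
* `abs_lineTail_le_geom` — **`|tail| ≤ C_A(i)C_A(j) ζ₂ · (1 + log q̂ + 2 log M)^{i+j} · (q̂²M²/q⁴)^A · (q²+1)^{i+j+1}`** (`2A ≥ i+j+1`).
On the window `Δ' ≤ 3/2` (`M = q̂^{Δ'} ≤ q^{3/4}`, `q̂² ≤ q`) the middle factor is `≤ q^{−3A/2}`: every line tail is `O_{A,i,j}(q^{−3A/2+2(i+j+1)}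
log^{i+j} q)`, and the remaining sum over `(i,j,m₁,m₂,d₁,d₂)` with `|x_m| ≤ B_P`, `c ≤ M`, `#pairs ≤ M⁴` is routine (census R1b).
Helper `--supports stmt-Parity-20007`; closes nothing; K_A, K_B and the Parity summit are NOT proved; nothing about Landau–Siegel zeros.
-/

noncomputable section

open scoped Real
open Finset MeasureTheory Set
open Literature.NumberTheory.LFunctions

namespace Summit.Parity.GeneralizedHardyLittlewood.Theorems.MomentsBeyondDiagonal.DiagLines

open Summit.Parity.GeneralizedHardyLittlewood.Theorems.BeyondDiagonalBeatsQuarter.PeterssonSplit (line_prod)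

/-- `K = (a/c)(b/c) = (d₁e₁)(d₂e₂)` (the line at `t = 1`). [cite: KowalskiMichelVanderKam2000, (23) p. 13 — derivation] -/
theorem lineK_eq {a b d₁ d₂ : ℕ} (hd₁ : d₁ ∣ a) (hd₂ : d₂ ∣ b) :
    (a / (a / d₁).gcd (b / d₂)) * (b / (a / d₁).gcd (b / d₂)) =
      (d₁ * (b / d₂ / (a / d₁).gcd (b / d₂))) * (d₂ * (a / d₁ / (a / d₁).gcd (b / d₂))) := by
  have h := line_prod hd₁ hd₂ 1
  simp only [mul_one, one_pow] at h
  exact h.symm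

/-- Real-variable core of the geometric lower bound: if `1 ≤ D₁`, `D₂ ≤ M²`, `q² ≤ D₂(T+1)` (reals, `Q > 0`, `M > 0`), then
`q⁴/(Q²M²) ≤ (D₁D₂/Q²)(T+1)²`. [folklore] -/
theorem geom_lower_aux {D₁ D₂ T N Q M : ℝ} (hD₁ : 1 ≤ D₁) (hD₂0 : 0 < D₂) (hD₂M : D₂ ≤ M ^ 2) (hQ : 0 < Q) (hM : 0 < M)
    (hN : 0 ≤ N) (hNT : N ≤ D₂ * (T + 1)) :
    N ^ 2 / (Q ^ 2 * M ^ 2) ≤ D₁ * D₂ / Q ^ 2 * (T + 1) ^ 2 := by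
  have h1 : N ^ 2 ≤ D₂ ^ 2 * (T + 1) ^ 2 := by
    rw [← mul_pow]; exact pow_le_pow_left₀ hN hNT 2
  calc N ^ 2 / (Q ^ 2 * M ^ 2) ≤ D₂ ^ 2 * (T + 1) ^ 2 / (Q ^ 2 * M ^ 2) := by gcongr
    _ ≤ D₂ ^ 2 * (T + 1) ^ 2 / (Q ^ 2 * D₂) := by gcongr
    _ = D₂ * (T + 1) ^ 2 / Q ^ 2 := by field_simp
    _ ≤ D₁ * D₂ * (T + 1) ^ 2 / Q ^ 2 := by
        gcongr
        nlinarith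
    _ = D₁ * D₂ / Q ^ 2 * (T + 1) ^ 2 := by ring

/-- **The box tail of one diagonal line, in the tree's variables.** For a level `q` with `q̂ ≥ 1`, a mollifier length `M ≥ 1`,
a pair `1 ≤ m₁, m₂ ≤ M`, Hecke divisors `d₁ ∣ m₁`, `d₂ ∣ m₂`, orders `i, j` and `2A ≥ i + j + 1` (notation of `…DiagLineSeries`):
`|Σ'_{l≥0} (l+1+T⋆)⁻¹ 𝒲_{ij}(A₁ − log(l+1+T⋆), A₂ − log(l+1+T⋆); y(l+1+T⋆)²)|
   ≤ C_A(i)C_A(j) · (1 + log q̂ + 2 log M)^i (1 + log q̂ + 2 log M)^j · ζ₂ · (q̂² M²/q⁴)^A · (q² + 1)^{i+j+1}`.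
[cite: KowalskiMichelVanderKam2000, (22)–(23) p. 12–13 — derivation] -/
theorem abs_lineTail_le_geom {q : ℕ} [NeZero q] (hqh : 1 ≤ KMV2000.qhat q) (i j : ℕ) {A : ℝ} (hA : (i + j + 1 : ℝ) ≤ 2 * A)
    {M : ℝ} (hM : 1 ≤ M) {m₁ m₂ d₁ d₂ : ℕ} (hm₁ : 1 ≤ m₁) (hm₂ : 1 ≤ m₂) (hm₁M : (m₁ : ℝ) ≤ M) (hm₂M : (m₂ : ℝ) ≤ M)
    (hd₁ : d₁ ∣ m₁) (hd₂ : d₂ ∣ m₂) :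
    |∑' l : ℕ, ((l : ℝ) + 1 + (min (q ^ 2 / (d₁ * (m₂ / d₂ / (m₁ / d₁).gcd (m₂ / d₂))))
        (q ^ 2 / (d₂ * (m₁ / d₁ / (m₁ / d₁).gcd (m₂ / d₂)))) : ℕ))⁻¹ *
      KMV2000.logCutoffW i j
        (Real.log (KMV2000.qhat q / ((d₁ * (m₂ / d₂ / (m₁ / d₁).gcd (m₂ / d₂)) : ℕ) : ℝ)) -
          Real.log ((l : ℝ) + 1 + (min (q ^ 2 / (d₁ * (m₂ / d₂ / (m₁ / d₁).gcd (m₂ / d₂))))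
            (q ^ 2 / (d₂ * (m₁ / d₁ / (m₁ / d₁).gcd (m₂ / d₂)))) : ℕ)))
        (Real.log (KMV2000.qhat q / ((d₂ * (m₁ / d₁ / (m₁ / d₁).gcd (m₂ / d₂)) : ℕ) : ℝ)) -
          Real.log ((l : ℝ) + 1 + (min (q ^ 2 / (d₁ * (m₂ / d₂ / (m₁ / d₁).gcd (m₂ / d₂))))
            (q ^ 2 / (d₂ * (m₁ / d₁ / (m₁ / d₁).gcd (m₂ / d₂)))) : ℕ)))
        (((((m₁ / (m₁ / d₁).gcd (m₂ / d₂)) * (m₂ / (m₁ / d₁).gcd (m₂ / d₂)) : ℕ) : ℝ) / KMV2000.qhat q ^ 2) *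
          ((l : ℝ) + 1 + (min (q ^ 2 / (d₁ * (m₂ / d₂ / (m₁ / d₁).gcd (m₂ / d₂))))
            (q ^ 2 / (d₂ * (m₁ / d₁ / (m₁ / d₁).gcd (m₂ / d₂)))) : ℕ)) ^ 2)| ≤
      ((∫ x in Ioi (0 : ℝ), x ^ A * (Real.exp (-x) * (2 ^ i * (1 + |Real.log x| ^ i)))) *
        ∫ x in Ioi (0 : ℝ), x ^ A * (Real.exp (-x) * (2 ^ j * (1 + |Real.log x| ^ j)))) *
      (1 + Real.log (KMV2000.qhat q) + 2 * Real.log M) ^ i * (1 + Real.log (KMV2000.qhat q) + 2 * Real.log M) ^ j *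
      (∑' n : ℕ, (((n : ℝ) + 1) ^ 2)⁻¹) *
      (KMV2000.qhat q ^ 2 * M ^ 2 / ((q : ℝ)) ^ 4) ^ A * (((q : ℝ)) ^ 2 + 1) ^ ((i + j : ℝ) + 1) := by
  -- names
  have hm₁0 : m₁ ≠ 0 := by omega
  have hm₂0 : m₂ ≠ 0 := by omega
  have hd₁0 : d₁ ≠ 0 := fun h ↦ hm₁0 (Nat.eq_zero_of_zero_dvd (h ▸ hd₁))
  have hd₂0 : d₂ ≠ 0 := fun h ↦ hm₂0 (Nat.eq_zero_of_zero_dvd (h ▸ hd₂))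
  have ha₁0 : m₁ / d₁ ≠ 0 := fun h ↦ hm₁0 (Nat.eq_zero_of_dvd_of_div_eq_zero hd₁ h)
  have ha₂0 : m₂ / d₂ ≠ 0 := fun h ↦ hm₂0 (Nat.eq_zero_of_dvd_of_div_eq_zero hd₂ h)
  set c : ℕ := (m₁ / d₁).gcd (m₂ / d₂) with hc
  set e₁ : ℕ := m₂ / d₂ / c with he₁
  set e₂ : ℕ := m₁ / d₁ / c with he₂
  have he₁0 : e₁ ≠ 0 := fun h ↦ ha₂0 (Nat.eq_zero_of_dvd_of_div_eq_zero (Nat.gcd_dvd_right _ _) h)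
  have he₂0 : e₂ ≠ 0 := fun h ↦ ha₁0 (Nat.eq_zero_of_dvd_of_div_eq_zero (Nat.gcd_dvd_left _ _) h)
  set D₁ : ℕ := d₁ * e₁ with hD₁
  set D₂ : ℕ := d₂ * e₂ with hD₂
  have hD₁0 : 0 < D₁ := Nat.pos_of_ne_zero (mul_ne_zero hd₁0 he₁0)
  have hD₂0 : 0 < D₂ := Nat.pos_of_ne_zero (mul_ne_zero hd₂0 he₂0)
  set K : ℕ := (m₁ / c) * (m₂ / c) with hK
  have hKD : K = D₁ * D₂ := lineK_eq hd₁ hd₂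
  set T : ℕ := min (q ^ 2 / D₁) (q ^ 2 / D₂) with hT
  set Q : ℝ := KMV2000.qhat q with hQ
  have hQ0 : 0 < Q := lt_of_lt_of_le one_pos hqh
  set y : ℝ := ((K : ℕ) : ℝ) / Q ^ 2 with hy
  have hK0 : 0 < K := by rw [hKD]; exact Nat.mul_pos hD₁0 hD₂0
  have hKpos : (0 : ℝ) < K := by exact_mod_cast hK0
  have hy0 : 0 < y := by rw [hy]; positivity
  -- sizes of `D₁, D₂`
  have hM0 : 0 < M := by linarith
  have hD₁le : (D₁ : ℝ) ≤ M ^ 2 := by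
    have h1 : (d₁ : ℝ) ≤ M := le_trans (by exact_mod_cast Nat.le_of_dvd (by omega) hd₁) hm₁M
    have h2 : (e₁ : ℝ) ≤ M := by
      have : e₁ ≤ m₂ := (Nat.div_le_self _ _).trans (Nat.div_le_self _ _)
      exact le_trans (by exact_mod_cast this) hm₂M
    rw [hD₁, Nat.cast_mul, sq]
    exact mul_le_mul h1 h2 (Nat.cast_nonneg _) hM0.le
  have hD₂le : (D₂ : ℝ) ≤ M ^ 2 := by
    have h1 : (d₂ : ℝ) ≤ M := le_trans (by exact_mod_cast Nat.le_of_dvd (by omega) hd₂) hm₂M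
    have h2 : (e₂ : ℝ) ≤ M := by
      have : e₂ ≤ m₁ := (Nat.div_le_self _ _).trans (Nat.div_le_self _ _)
      exact le_trans (by exact_mod_cast this) hm₁M
    rw [hD₂, Nat.cast_mul, sq]
    exact mul_le_mul h1 h2 (Nat.cast_nonneg _) hM0.le
  have hD₁1 : (1 : ℝ) ≤ D₁ := by exact_mod_cast hD₁0
  have hD₂1 : (1 : ℝ) ≤ D₂ := by exact_mod_cast hD₂0
  -- the log shifts
  have hlogM : 0 ≤ Real.log M := Real.log_nonneg hM
  have hlogQ : 0 ≤ Real.log Q := Real.log_nonneg hqh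
  have hAbound : ∀ {D : ℕ}, (1 : ℝ) ≤ D → (D : ℝ) ≤ M ^ 2 → 1 + |Real.log (Q / D)| ≤ 1 + Real.log Q + 2 * Real.log M := by
    intro D hD1 hDM
    have hD0 : (0 : ℝ) < D := by linarith
    rw [Real.log_div hQ0.ne' hD0.ne']
    have hlD : 0 ≤ Real.log D := Real.log_nonneg hD1
    have hlD' : Real.log D ≤ 2 * Real.log M := by
      calc Real.log D ≤ Real.log (M ^ 2) := Real.log_le_log hD0 hDM
        _ = 2 * Real.log M := by rw [Real.log_pow]; norm_num
    have : |Real.log Q - Real.log D| ≤ Real.log Q + Real.log D := by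
      rw [abs_le]; constructor <;> linarith
    linarith
  have hA₁ := hAbound hD₁1 hD₁le
  have hA₂ := hAbound hD₂1 hD₂le
  -- the Rankin bound of `…DiagLineTail`
  have htail := abs_tsum_lineTail_le i j hA (Real.log (Q / D₁)) (Real.log (Q / D₂)) hy0 T
  -- geometry: `q² ≤ D_max (T + 1)`, hence `q⁴/(Q²M²) ≤ y (T+1)²`
  have hgeom : ((q : ℝ)) ^ 4 / (Q ^ 2 * M ^ 2) ≤ y * ((T : ℝ) + 1) ^ 2 := by
    have hT0 : (0 : ℝ) ≤ (T : ℝ) + 1 := by positivity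
    have hq0 : (0 : ℝ) ≤ ((q : ℝ)) ^ 2 := by positivity
    rw [show ((q : ℝ)) ^ 4 = (((q : ℝ)) ^ 2) ^ 2 by ring, hy, hKD, Nat.cast_mul]
    rcases le_total D₁ D₂ with h | h
    · -- `T = q²/D₂`
      have hTeq : T = q ^ 2 / D₂ := by rw [hT]; exact min_eq_right (Nat.div_le_div_left h hD₁0)
      have hlt : q ^ 2 < D₂ * (T + 1) := by rw [hTeq]; exact Nat.lt_mul_div_succ _ hD₂0
      have hle : ((q : ℝ)) ^ 2 ≤ (D₂ : ℝ) * ((T : ℝ) + 1) := by exact_mod_cast hlt.le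
      exact geom_lower_aux hD₁1 (by linarith) hD₂le hQ0 hM0 hq0 hle
    · have hTeq : T = q ^ 2 / D₁ := by rw [hT]; exact min_eq_left (Nat.div_le_div_left h hD₂0)
      have hlt : q ^ 2 < D₁ * (T + 1) := by rw [hTeq]; exact Nat.lt_mul_div_succ _ hD₁0
      have hle : ((q : ℝ)) ^ 2 ≤ (D₁ : ℝ) * ((T : ℝ) + 1) := by exact_mod_cast hlt.le
      have h' := geom_lower_aux hD₂1 (by linarith) hD₁le hQ0 hM0 hq0 hle
      calc (((q : ℝ)) ^ 2) ^ 2 / (Q ^ 2 * M ^ 2) ≤ (D₂ : ℝ) * D₁ / Q ^ 2 * ((T : ℝ) + 1) ^ 2 := h'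
        _ = (D₁ : ℝ) * D₂ / Q ^ 2 * ((T : ℝ) + 1) ^ 2 := by ring
  -- `T + 1 ≤ q² + 1`
  have hTle : (T : ℝ) + 1 ≤ ((q : ℝ)) ^ 2 + 1 := by
    have : T ≤ q ^ 2 := (min_le_left _ _).trans (Nat.div_le_self _ _)
    have : (T : ℝ) ≤ ((q ^ 2 : ℕ) : ℝ) := by exact_mod_cast this
    push_cast at this
    linarith
  -- rewrite `y^{-A}(T+1)^{i+j+1-2A} = (y(T+1)²)^{-A}(T+1)^{i+j+1}` and bound
  have hT0 : (0 : ℝ) < (T : ℝ) + 1 := by positivity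
  have hpow : y ^ (-A) * ((T : ℝ) + 1) ^ ((i + j : ℝ) + 1 - 2 * A) =
      (y * ((T : ℝ) + 1) ^ 2) ^ (-A) * ((T : ℝ) + 1) ^ ((i + j : ℝ) + 1) := by
    rw [Real.mul_rpow hy0.le (by positivity), ← Real.rpow_natCast ((T : ℝ) + 1) 2, ← Real.rpow_mul hT0.le,
      show ((i + j : ℝ) + 1 - 2 * A) = ((i + j : ℝ) + 1) + ((2 : ℕ) : ℝ) * -A by push_cast; ring, Real.rpow_add hT0]
    ring
  have hmid : (y * ((T : ℝ) + 1) ^ 2) ^ (-A) ≤ (Q ^ 2 * M ^ 2 / ((q : ℝ)) ^ 4) ^ A := by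
    have hA0 : 0 ≤ A := by
      have : (0 : ℝ) ≤ i + j + 1 := by positivity
      linarith
    have hq0 : (0 : ℝ) < q := by exact_mod_cast NeZero.pos q
    have hpos : 0 < ((q : ℝ)) ^ 4 / (Q ^ 2 * M ^ 2) := by positivity
    calc (y * ((T : ℝ) + 1) ^ 2) ^ (-A) ≤ (((q : ℝ)) ^ 4 / (Q ^ 2 * M ^ 2)) ^ (-A) :=
          Real.rpow_le_rpow_of_nonpos hpos hgeom (by linarith)
      _ = (Q ^ 2 * M ^ 2 / ((q : ℝ)) ^ 4) ^ A := by
          rw [Real.rpow_neg hpos.le, ← Real.inv_rpow hpos.le, inv_div]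
  have hlast : ((T : ℝ) + 1) ^ ((i + j : ℝ) + 1) ≤ (((q : ℝ)) ^ 2 + 1) ^ ((i + j : ℝ) + 1) :=
    Real.rpow_le_rpow hT0.le hTle (by positivity)
  -- constants are non-negative
  have hC0 : 0 ≤ (∫ x in Ioi (0 : ℝ), x ^ A * (Real.exp (-x) * (2 ^ i * (1 + |Real.log x| ^ i)))) *
      ∫ x in Ioi (0 : ℝ), x ^ A * (Real.exp (-x) * (2 ^ j * (1 + |Real.log x| ^ j))) := by
    have h1 : 0 ≤ ∫ x in Ioi (0 : ℝ), x ^ A * (Real.exp (-x) * (2 ^ i * (1 + |Real.log x| ^ i))) :=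
      setIntegral_nonneg measurableSet_Ioi fun x hx ↦ by have hx : (0 : ℝ) < x := hx; positivity
    have h2 : 0 ≤ ∫ x in Ioi (0 : ℝ), x ^ A * (Real.exp (-x) * (2 ^ j * (1 + |Real.log x| ^ j))) :=
      setIntegral_nonneg measurableSet_Ioi fun x hx ↦ by have hx : (0 : ℝ) < x := hx; positivity
    exact mul_nonneg h1 h2
  have hζ0 : 0 ≤ ∑' n : ℕ, (((n : ℝ) + 1) ^ 2)⁻¹ := tsum_nonneg fun n ↦ by positivity
  have hA₁0 : 0 ≤ 1 + |Real.log (Q / D₁)| := by positivity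
  have hA₂0 : 0 ≤ 1 + |Real.log (Q / D₂)| := by positivity
  -- assemble
  refine htail.trans ?_
  rw [mul_assoc _ (y ^ (-A)), hpow]
  calc (∫ x in Ioi (0 : ℝ), x ^ A * (Real.exp (-x) * (2 ^ i * (1 + |Real.log x| ^ i)))) *
          (∫ x in Ioi (0 : ℝ), x ^ A * (Real.exp (-x) * (2 ^ j * (1 + |Real.log x| ^ j)))) *
        (1 + |Real.log (Q / D₁)|) ^ i * (1 + |Real.log (Q / D₂)|) ^ j * (∑' n : ℕ, (((n : ℝ) + 1) ^ 2)⁻¹) *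
        ((y * ((T : ℝ) + 1) ^ 2) ^ (-A) * ((T : ℝ) + 1) ^ ((i + j : ℝ) + 1))
      ≤ (∫ x in Ioi (0 : ℝ), x ^ A * (Real.exp (-x) * (2 ^ i * (1 + |Real.log x| ^ i)))) *
          (∫ x in Ioi (0 : ℝ), x ^ A * (Real.exp (-x) * (2 ^ j * (1 + |Real.log x| ^ j)))) *
        (1 + Real.log Q + 2 * Real.log M) ^ i * (1 + Real.log Q + 2 * Real.log M) ^ j * (∑' n : ℕ, (((n : ℝ) + 1) ^ 2)⁻¹) *
        ((Q ^ 2 * M ^ 2 / ((q : ℝ)) ^ 4) ^ A * (((q : ℝ)) ^ 2 + 1) ^ ((i + j : ℝ) + 1)) := by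
        gcongr
    _ = _ := by ring

end Summit.Parity.GeneralizedHardyLittlewood.Theorems.MomentsBeyondDiagonal.DiagLines

end
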